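import Literature.MathematicalPhysics.QuantumFieldTheory.Balaban1983to89.B12Eq311RemainderBound
import Literature.MathematicalPhysics.QuantumFieldTheory.Balaban1983to89.B12Eq311Landau
import Literature.MathematicalPhysics.QuantumFieldTheory.Balaban1983to89.B12Membership313J

/-!
# `Balaban1983to89.B12Eq313JSlot` — T. Bałaban, *Renormalization group approach to lattice gauge field theories. I*,
Commun. Math. Phys. **109** (1987) 249–301 [Balaban1987RG1]: **the 𝐉-argument of (3.13) with the bound on `𝐅₁` DERIVED**.
p. 272: *«Thus we obtain the following function of the variables 𝐔, 𝐉: E^{(j)}(X, exp iξ𝐀𝐔, (L^{j−1}η)³𝐉 + Δ^ξ_𝐔𝐀 − P₁𝐀 + 𝐅₁(𝐔, 𝐀)) (3.13) … there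
exists a constant α₂, depending on α₀ and on some absolute constants, such that the function (3.13) is analytic in 𝐀, for 𝐀 satisfying
the conditions |𝐀|, |P^ξ_𝐔𝐀|, |F^ξ_𝐔𝐀|, |Δ^ξ_𝐔𝐀| < α₂ on X. (3.14)»*.  `B12Membership313J.jArg_norm_lt` proved the 𝐉-slot of this
membership with the bound `‖𝐅₁‖ ≤ C_F·α₂` as a HYPOTHESIS («the one genuinely un-displayed input», its header (b)).  Here that
hypothesis is DISCHARGED from the (3.11) line of this unit: `𝐅₁(𝐔, 𝐀) := 𝐅(𝐔, 𝐀) − π(ξ⁻²𝒦𝐀)` — the local remainder of (3.11)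
(`B12Eq311RemainderBound.norm_F311_le_linear`: `≤ (d − 1)CπC_F(ρ)α₂`) plus the «lower order, local operator» of the Landau-gauge
replacement `D*D = Δ − P₁ − ξ⁻²𝒦` (`B12Eq311Landau.lapCur_landau`; `𝒦 = B11Eq135Weitzenbock.curvOp`, here bounded on a background
of units with `‖U(b)^{±1}‖ ≤ ρ`: `norm_curvOp_le_of_le`, `≤ 2(d − 1)ρ¹⁰δa`; B11's `norm_curvOp_le` is `ρ = 1`) — so that
`‖𝐅₁(𝐔, 𝐀)(b)‖ ≤ (d − 1)·Cπ·(C_F(ρ) + 2ρ¹⁴)·α₂` (`norm_FOne_le`, torus `norm_FOne_le_torus`), the J-argument is identified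
(`current_sub310_landau`: `J(e^{iξ𝐀}𝐔) = J(𝐔) + π(Δ^ξ_𝐔𝐀) − π(P₁𝐀) + 𝐅₁(𝐔, 𝐀)`, `P₁ = D^ξPξ⁻¹D^{ξ*}`), and the 𝐉-slot bound
follows with an explicit restriction on `α₂` (`jSlot_norm_lt`).

HONEST FRAMING (cell `lit-balaban`, verbatim): statement-level skeleton of published theorems with citation tags; proofs where landed; nothing here is a claim about the Yang–Mills mass gap.

PDF held: `paper:balaban1987-cmp109-rg-i-small-field` (journal page = PDF page + 248); p. 272 re-read by this unit; [15] = [Balaban1985Variational]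
p. 298 ((135)) read as the render `b2b-balaban-ref1/pages/1985-cmp102-variational-background/…-p022-x2.png`.

HONEST SCOPE.  (a) `𝐅₁` is not printed in closed form («from the form of the expressions in (3.13)»); OUR `𝐅₁ = 𝐅 − π(ξ⁻²𝒦𝐀)` is what
(3.11) + the printed replacement sentence produce, and the theorem names say so; it is written out, not introduced as a definition.
(b) The hypotheses are global (all bonds ∕ plaquettes of the torus) where the print localises to `X`; the (3.14) quantities `|Δ^ξ_𝐔𝐀|`,
`|P₁𝐀|` (inside `π`) stay hypotheses exactly as in (3.14); `R`, `P` are any maps of site fields with `R + P = I` and the Landau condition is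
`R(ξ⁻¹D^{ξ*}𝐀) = 0` ((180) [15] by reference).  (c) Constants explicit and not optimised (`ρ¹⁴ = ρ¹⁰·ρ⁴`, the `ρ⁴` converting the one-sided
plaquette hypothesis to both orientations, `plaqU_swap`).  (d) Item (iv) and the 𝐔-slot of the membership are `B12Membership313II*` ∕
`B12Lemma4Space` business and are not touched.  No definition, no `Prop` placeholder, no new fact; axioms standard.
Unit `lit-balaban-p07` (Phase-2 seat p07 gen 7; rows B12.Eq3.10-3.12 ∕ B12.Eq3.13-3.14, owners r09/r20), HOME `run/shared/lean/pub/lit-balaban/`.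
-/

open NormedSpace Complex

namespace Literature.MathematicalPhysics.QuantumFieldTheory.Balaban1983to89.B12Eq313JSlot

open Literature.MathematicalPhysics.QuantumFieldTheory.Balaban1983to89
open Literature.MathematicalPhysics.QuantumFieldTheory.Balaban1983to89.B9Eq39Adjoint
open Literature.MathematicalPhysics.QuantumFieldTheory.Balaban1983to89.B9Eq369Small
open Literature.MathematicalPhysics.QuantumFieldTheory.Balaban1983to89.B9TorusCalculus
open Literature.MathematicalPhysics.QuantumFieldTheory.Balaban1983to89.B9Eq352ScalarFluct (siteLap)
open Literature.MathematicalPhysics.QuantumFieldTheory.Balaban1983to89.B9Eq3117Current (covDη covDη_apply)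
open Literature.MathematicalPhysics.QuantumFieldTheory.Balaban1983to89.B11Eq135Weitzenbock
open Literature.MathematicalPhysics.QuantumFieldTheory.Balaban1983to89.B12Eq311CurrentExpansion
open Literature.MathematicalPhysics.QuantumFieldTheory.Balaban1983to89.B12Eq311RemainderBound
open Literature.MathematicalPhysics.QuantumFieldTheory.Balaban1983to89.B12Eq311Landau
open Literature.MathematicalPhysics.QuantumFieldTheory.Balaban1983to89.B9Eq369Product (norm_eta_inv_smul_le_iff)

noncomputable section

/-! ## §1. The curvature operator of (135) [15] on a background of units with `‖U(b)^{±1}‖ ≤ ρ` -/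

section Curvature

variable {𝔸 : Type*} [NormedRing 𝔸] {S : Type*} {ι : Type*}
variable (T : ι → Equiv.Perm S) (U : ι → S → 𝔸ˣ)

/-- `‖R(W)X − X‖ ≤ 2r·‖W − 1‖·‖X‖` for a unit `W` with `‖W⁻¹‖ ≤ r`: `WXW⁻¹ − X = (W − 1)XW⁻¹ + XW⁻¹(1 − W)`
(`B11Eq135Weitzenbock.norm_R_sub_self_le` is the case `r = 1`). [cite: Balaban1985Variational, (135) p.298] -/
theorem norm_R_sub_self_le_of_le {W : 𝔸ˣ} {r : ℝ} (h₂ : ‖((W⁻¹ : 𝔸ˣ) : 𝔸)‖ ≤ r) (X : 𝔸) :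
    ‖R W X - X‖ ≤ 2 * r * ‖(W : 𝔸) - 1‖ * ‖X‖ := by
  have hr : 0 ≤ r := (norm_nonneg _).trans h₂
  have e : R W X - X = ((W : 𝔸) - 1) * X * ((W⁻¹ : 𝔸ˣ) : 𝔸) + X * ((W⁻¹ : 𝔸ˣ) : 𝔸) * (1 - (W : 𝔸)) := by
    simp only [R_def, sub_mul, mul_sub, one_mul, mul_one, mul_assoc, Units.inv_mul]
    abel
  rw [e]
  have n1 : ‖((W : 𝔸) - 1) * X * ((W⁻¹ : 𝔸ˣ) : 𝔸)‖ ≤ ‖(W : 𝔸) - 1‖ * ‖X‖ * r :=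
    (norm_mul_le _ _).trans (mul_le_mul (norm_mul_le _ _) h₂ (norm_nonneg _)
      (mul_nonneg (norm_nonneg _) (norm_nonneg _)))
  have n2 : ‖X * ((W⁻¹ : 𝔸ˣ) : 𝔸) * (1 - (W : 𝔸))‖ ≤ ‖X‖ * r * ‖(W : 𝔸) - 1‖ := by
    refine (norm_mul_le _ _).trans (mul_le_mul ((norm_mul_le _ _).trans ?_) (le_of_eq (norm_sub_rev _ _))
      (norm_nonneg _) (mul_nonneg (norm_nonneg _) hr))
    exact mul_le_mul_of_nonneg_left h₂ (norm_nonneg _)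
  exact (norm_add_le_of_le n1 n2).trans (le_of_eq (by ring))

/-- Reversing the orientation inverts the plaquette variable: `U(∂p_{νκ}(y)) = U(∂p_{κν}(y))⁻¹` ((3.5) [5]).
[cite: Balaban1985BackgroundPropagators, (3.5) p.391] -/
theorem plaqU_swap (κ ν : ι) (y : S) : plaqU T U ν κ y = (plaqU T U κ ν y)⁻¹ :=
  Units.ext (by rw [plaqU_inv_val]; simp only [plaqU, Units.val_mul])

/-- … hence `‖U(∂p_{νκ}(y)) − 1‖ ≤ ρ⁴‖U(∂p_{κν}(y)) − 1‖` for bond variables with `‖U(b)^{±1}‖ ≤ ρ`: a one-sided (`κ < ν`)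
plaquette hypothesis controls both orientations. [cite: Balaban1985BackgroundPropagators, (3.5) p.391] -/
theorem norm_plaqU_swap_sub_one_le {ρ : ℝ} (hUρ : ∀ μ x, ‖(U μ x : 𝔸)‖ ≤ ρ ∧ ‖(((U μ x)⁻¹ : 𝔸ˣ) : 𝔸)‖ ≤ ρ)
    (κ ν : ι) (y : S) : ‖(plaqU T U ν κ y : 𝔸) - 1‖ ≤ ρ ^ 4 * ‖(plaqU T U κ ν y : 𝔸) - 1‖ := by
  rw [plaqU_swap]
  exact norm_inv_sub_one_le (norm_plaqU_inv_le T U hUρ κ ν y)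

/-- The holonomy of the contour `p′_μν(x)` of (135) vs. the plaquette variable it is conjugate to
(`B11Eq135Weitzenbock.plaqU'_eq_conj`), transports of size `ρ`: `‖U(∂p′_μν(x)) − 1‖ ≤ ρ²‖U(∂p_{μν}(x − e_ν)) − 1‖`.
[cite: Balaban1985Variational, (135) p.298] -/
theorem norm_plaqU'_sub_one_le_of_le (hT : ∀ μ ν x, T μ (T ν x) = T ν (T μ x)) {ρ : ℝ}
    (hUρ : ∀ μ x, ‖(U μ x : 𝔸)‖ ≤ ρ ∧ ‖(((U μ x)⁻¹ : 𝔸ˣ) : 𝔸)‖ ≤ ρ) (μ ν : ι) (x : S) :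
    ‖(plaqU' T U μ ν x : 𝔸) - 1‖ ≤ ρ ^ 2 * ‖(plaqU T U μ ν ((T ν).symm x) : 𝔸) - 1‖ := by
  have e : (plaqU' T U μ ν x : 𝔸) - 1
      = (((U μ ((T ν).symm x))⁻¹ : 𝔸ˣ) : 𝔸) * ((plaqU T U μ ν ((T ν).symm x) : 𝔸) - 1)
          * (U μ ((T ν).symm x) : 𝔸) := by
    rw [plaqU'_eq_conj T U hT, Units.val_mul, Units.val_mul, mul_sub, sub_mul, mul_one, Units.inv_mul]
  rw [e]
  calc ‖(((U μ ((T ν).symm x))⁻¹ : 𝔸ˣ) : 𝔸) * ((plaqU T U μ ν ((T ν).symm x) : 𝔸) - 1) * (U μ ((T ν).symm x) : 𝔸)‖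
      ≤ ρ * ‖(plaqU T U μ ν ((T ν).symm x) : 𝔸) - 1‖ * ρ :=
        norm_mul_le_of_le (norm_mul_le_of_le (hUρ μ _).2 le_rfl) (hUρ μ _).1
    _ = ρ ^ 2 * ‖(plaqU T U μ ν ((T ν).symm x) : 𝔸) - 1‖ := by ring

/-- ONE SUMMAND of the curvature operator on a `ρ`-background:
`‖R(transp)[R(U(∂p′_μν(x))) − 1]A_ν(z)‖ ≤ 2ρ¹⁰·‖U(∂p_{μν}(x − e_ν)) − 1‖·‖A_ν(z)‖` (`ρ⁴` from the outer transport, `ρ⁴` from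
`‖U(∂p′)⁻¹‖`, `ρ²` from the conjugation; `B11Eq135Weitzenbock.norm_curvOp_summand_le` is `ρ = 1`). [cite: Balaban1985Variational, (135) p.298] -/
theorem norm_curvOp_summand_le_of_le (hT : ∀ μ ν x, T μ (T ν x) = T ν (T μ x)) {ρ : ℝ}
    (hUρ : ∀ μ x, ‖(U μ x : 𝔸)‖ ≤ ρ ∧ ‖(((U μ x)⁻¹ : 𝔸ˣ) : 𝔸)‖ ≤ ρ) (A : ι → S → 𝔸) (μ ν : ι) (x : S) :
    ‖R (transp T U μ ν x)
        (R (plaqU' T U μ ν x) (A ν ((T ν).symm (T μ x))) - A ν ((T ν).symm (T μ x)))‖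
      ≤ 2 * ρ ^ 10 * ‖(plaqU T U μ ν ((T ν).symm x) : 𝔸) - 1‖ * ‖A ν ((T ν).symm (T μ x))‖ := by
  have hρ : 0 ≤ ρ := (norm_nonneg _).trans (hUρ μ x).1
  have ht1 : ‖(transp T U μ ν x : 𝔸)‖ ≤ ρ ^ 2 := by
    rw [transp_def, Units.val_mul]
    exact (norm_mul_le_of_le (hUρ μ x).1 (hUρ ν _).2).trans (le_of_eq (by ring))
  have ht2 : ‖(((transp T U μ ν x)⁻¹ : 𝔸ˣ) : 𝔸)‖ ≤ ρ ^ 2 := by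
    rw [transp_def, mul_inv_rev, inv_inv, Units.val_mul]
    exact (norm_mul_le_of_le (hUρ ν _).1 (hUρ μ x).2).trans (le_of_eq (by ring))
  have hp2 : ‖(((plaqU' T U μ ν x)⁻¹ : 𝔸ˣ) : 𝔸)‖ ≤ ρ ^ 4 := by
    rw [plaqU'_def]
    simp only [mul_inv_rev, inv_inv, Units.val_mul, ← mul_assoc]
    exact (norm_mul_le_of_le (norm_mul_le_of_le (norm_mul_le_of_le (hUρ μ _).2 (hUρ ν _).1) (hUρ μ x).1)
      (hUρ ν _).2).trans (le_of_eq (by ring))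
  have hX := norm_nonneg (A ν ((T ν).symm (T μ x)))
  have hPn := norm_nonneg ((plaqU T U μ ν ((T ν).symm x) : 𝔸) - 1)
  calc ‖R (transp T U μ ν x)
          (R (plaqU' T U μ ν x) (A ν ((T ν).symm (T μ x))) - A ν ((T ν).symm (T μ x)))‖
      ≤ (ρ ^ 2) ^ 2 * ‖R (plaqU' T U μ ν x) (A ν ((T ν).symm (T μ x))) - A ν ((T ν).symm (T μ x))‖ :=
        norm_R_le_rho ht1 ht2 _
    _ ≤ (ρ ^ 2) ^ 2 * (2 * ρ ^ 4 * ‖(plaqU' T U μ ν x : 𝔸) - 1‖ * ‖A ν ((T ν).symm (T μ x))‖) :=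
        mul_le_mul_of_nonneg_left (norm_R_sub_self_le_of_le hp2 _) (by positivity)
    _ ≤ (ρ ^ 2) ^ 2 * (2 * ρ ^ 4 * (ρ ^ 2 * ‖(plaqU T U μ ν ((T ν).symm x) : 𝔸) - 1‖)
          * ‖A ν ((T ν).symm (T μ x))‖) := by
        have h := norm_plaqU'_sub_one_le_of_le T U hT hUρ μ ν x
        gcongr
    _ = 2 * ρ ^ 10 * ‖(plaqU T U μ ν ((T ν).symm x) : 𝔸) - 1‖ * ‖A ν ((T ν).symm (T μ x))‖ := by ring

variable [Fintype ι]

/-- **The curvature operator of (135) on a `ρ`-background** («lower order, local operator» of [B12] p. 272): if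
`‖U(∂p_{μν}(y)) − 1‖ ≤ δ` for `μ ≠ ν` and `‖A_ν(y)‖ ≤ a`, then `‖(𝒦A)_μ(x)‖ ≤ 2(d − 1)·ρ¹⁰·δ·a` (`ρ = 1`:
`B11Eq135Weitzenbock.norm_curvOp_le`). [cite: Balaban1985Variational, (135)–(136) p.298; Balaban1987RG1, (3.11) p.272] -/
theorem norm_curvOp_le_of_le (hT : ∀ μ ν x, T μ (T ν x) = T ν (T μ x)) {ρ : ℝ}
    (hUρ : ∀ μ x, ‖(U μ x : 𝔸)‖ ≤ ρ ∧ ‖(((U μ x)⁻¹ : 𝔸ˣ) : 𝔸)‖ ≤ ρ) {δ a : ℝ}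
    (hP : ∀ μ ν y, μ ≠ ν → ‖(plaqU T U μ ν y : 𝔸) - 1‖ ≤ δ) {A : ι → S → 𝔸} (hA : ∀ ν y, ‖A ν y‖ ≤ a)
    (μ : ι) (x : S) :
    ‖curvOp T U A μ x‖ ≤ 2 * (Fintype.card ι - 1 : ℝ) * ρ ^ 10 * δ * a := by
  have hρ : 0 ≤ ρ := (norm_nonneg _).trans (hUρ μ x).1
  have hmain := norm_sum_le_of_forall_ne
    (fun ν => R (transp T U μ ν x)
      (R (plaqU' T U μ ν x) (A ν ((T ν).symm (T μ x))) - A ν ((T ν).symm (T μ x))))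
    μ (2 * ρ ^ 10 * δ * a) (curvOp_summand_self T U A μ x) (fun ν hne => by
      have hPle := hP μ ν ((T ν).symm x) hne.symm
      have hδ : 0 ≤ δ := (norm_nonneg _).trans hPle
      exact (norm_curvOp_summand_le_of_le T U hT hUρ A μ ν x).trans
        (mul_le_mul (mul_le_mul_of_nonneg_left hPle (by positivity)) (hA ν _) (norm_nonneg _)
          (mul_nonneg (by positivity) hδ)))
  rw [curvOp_def]
  exact hmain.trans (le_of_eq (by ring))

end Curvature

/-! ## §2. In the units of [B12]: `‖ξ⁻²π(𝒦𝐀)‖ ≤ 2(d − 1)·Cπ·ρ¹⁴·α₀·α₂` -/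

section Units

variable {𝔸 : Type*} [NormedRing 𝔸] [NormedAlgebra ℂ 𝔸] {S : Type*} {ι : Type*} [Fintype ι] [LinearOrder ι]
variable (T : ι → Equiv.Perm S) (U : ι → S → 𝔸ˣ)
variable {ρ ξ Cπ α₀ α₂ : ℝ} {A : ι → S → 𝔸} {π : 𝔸 →ₗ[ℂ] 𝔸}

omit [NormedAlgebra ℂ 𝔸] [Fintype ι] in
/-- From the one-sided plaquette hypothesis of the spaces (1.11)–(1.14) (`‖U(∂p) − 1‖ ≤ α₀ξ²`, positively oriented `p`) to both
orientations with `δ = ρ⁴α₀ξ²` (`1 ≤ ρ`). [cite: Balaban1987RG1, (1.11)–(1.14) p.262; Balaban1985BackgroundPropagators, (3.5) p.391] -/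
theorem norm_plaqU_sub_one_le_two_sided (hρ : 1 ≤ ρ)
    (hU : ∀ μ x, ‖(U μ x : 𝔸)‖ ≤ ρ ∧ ‖(((U μ x)⁻¹ : 𝔸ˣ) : 𝔸)‖ ≤ ρ) (hα₀ : 0 ≤ α₀)
    (hP : ∀ κ ν, κ < ν → ∀ y, ‖(plaqU T U κ ν y : 𝔸) - 1‖ ≤ α₀ * ξ ^ 2) (μ ν : ι) (y : S) (hne : μ ≠ ν) :
    ‖(plaqU T U μ ν y : 𝔸) - 1‖ ≤ ρ ^ 4 * (α₀ * ξ ^ 2) := by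
  have hρ4 : 1 ≤ ρ ^ 4 := one_le_pow₀ hρ
  have hε : 0 ≤ α₀ * ξ ^ 2 := mul_nonneg hα₀ (sq_nonneg ξ)
  rcases lt_or_gt_of_ne hne with h | h
  · exact (hP μ ν h y).trans (le_mul_of_one_le_left hε hρ4)
  · exact (norm_plaqU_swap_sub_one_le T U hU ν μ y).trans
      (mul_le_mul_of_nonneg_left (hP ν μ h y) (by positivity))

/-- **The «lower order, local operator» of p. 272 in the units of [B12]**: for `0 < ξ`, `‖U(b)^{±1}‖ ≤ ρ` (`1 ≤ ρ`), `|𝐀| ≤ α₂`,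
`|U(∂p) − 1| ≤ α₀ξ²` (positively oriented plaquettes, `0 ≤ α₀`), `‖πX‖ ≤ Cπ‖X‖`, on commuting unit translations:
`‖π(ξ⁻²(𝒦𝐀)_μ(x))‖ ≤ (d − 1)·(2Cπρ¹⁴α₀)·α₂`. [cite: Balaban1987RG1, (3.11)–(3.14) p.272; Balaban1985Variational, (135) p.298] -/
theorem norm_pi_curvOp_le (hT : ∀ μ ν x, T μ (T ν x) = T ν (T μ x)) (hξ : 0 < ξ) (hρ : 1 ≤ ρ)
    (hU : ∀ μ x, ‖(U μ x : 𝔸)‖ ≤ ρ ∧ ‖(((U μ x)⁻¹ : 𝔸ˣ) : 𝔸)‖ ≤ ρ) (hα₀ : 0 ≤ α₀)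
    (hA : ∀ μ x, ‖A μ x‖ ≤ α₂) (hP : ∀ κ ν, κ < ν → ∀ y, ‖(plaqU T U κ ν y : 𝔸) - 1‖ ≤ α₀ * ξ ^ 2)
    (hCπ : 0 ≤ Cπ) (hπn : ∀ X, ‖π X‖ ≤ Cπ * ‖X‖) (μ : ι) (x : S) :
    ‖π ((((ξ : ℂ)⁻¹) ^ 2) • curvOp T U A μ x)‖ ≤ (Fintype.card ι - 1) * (2 * Cπ * ρ ^ 14 * α₀ * α₂) := by
  have hK := norm_curvOp_le_of_le T U hT hU (norm_plaqU_sub_one_le_two_sided T U hρ hU hα₀ hP) hA μ x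
  have hn : ‖(((ξ : ℂ)⁻¹) ^ 2)‖ = (ξ ^ 2)⁻¹ := norm_eta_inv_sq ξ
  have hd : (0 : ℝ) ≤ Fintype.card ι - 1 := by
    have : (1 : ℝ) ≤ Fintype.card ι := by exact_mod_cast Fintype.card_pos_iff.mpr ⟨μ⟩
    linarith
  have hξ2 : 0 < ξ ^ 2 := pow_pos hξ 2
  calc ‖π ((((ξ : ℂ)⁻¹) ^ 2) • curvOp T U A μ x)‖ ≤ Cπ * ‖(((ξ : ℂ)⁻¹) ^ 2) • curvOp T U A μ x‖ := hπn _
    _ = Cπ * ((ξ ^ 2)⁻¹ * ‖curvOp T U A μ x‖) := by rw [norm_smul, hn]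
    _ ≤ Cπ * ((ξ ^ 2)⁻¹ * (2 * (Fintype.card ι - 1 : ℝ) * ρ ^ 10 * (ρ ^ 4 * (α₀ * ξ ^ 2)) * α₂)) := by
        gcongr
    _ = (Fintype.card ι - 1) * (2 * Cπ * ρ ^ 14 * α₀ * α₂) := by
        field_simp

variable [CompleteSpace 𝔸] in
/-- **The bound on `𝐅₁` of (3.13)** — `𝐅₁(U, 𝐀) := 𝐅(U, 𝐀) − π(ξ⁻²𝒦𝐀)`, the local remainder of (3.11) together with the
«lower order, local operator» of the Landau-gauge replacement —, in the units of [B12] (`0 < ξ ≤ 1`, `1 ≤ ρ`, `α₀, α₂ ≤ 1`,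
`|𝐀| ≤ α₂`, `|D¹_U𝐀| ≤ ξα₂`, `|U(∂p) − 1| ≤ α₀ξ²`, `‖πX‖ ≤ Cπ‖X‖`, `π` commuting with the transports, commuting unit translations):
`‖𝐅₁(U, 𝐀)(b)‖ ≤ (d − 1)·Cπ·(C_F(ρ) + 2ρ¹⁴)·α₂` — the hypothesis `‖𝐅₁‖ ≤ C_F·α₂` of `B12Membership313J.jArg_norm_lt` DERIVED.
[cite: Balaban1987RG1, (3.11)–(3.14) p.272; Balaban1985RegularSpaces, (1.54) p.85; Balaban1985Variational, (135) p.298] -/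
theorem norm_FOne_le (hT : ∀ μ ν x, T μ (T ν x) = T ν (T μ x)) (hξ : 0 < ξ) (hξ1 : ξ ≤ 1) (hρ : 1 ≤ ρ)
    (hU : ∀ μ x, ‖(U μ x : 𝔸)‖ ≤ ρ ∧ ‖(((U μ x)⁻¹ : 𝔸ˣ) : 𝔸)‖ ≤ ρ)
    (hα₀ : 0 ≤ α₀) (hα₀1 : α₀ ≤ 1) (hα₂1 : α₂ ≤ 1)
    (hA : ∀ μ x, ‖A μ x‖ ≤ α₂) (hDA : ∀ κ ν y, ‖covD T U κ (A ν) y‖ ≤ ξ * α₂)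
    (hP : ∀ κ ν, κ < ν → ∀ y, ‖(plaqU T U κ ν y : 𝔸) - 1‖ ≤ α₀ * ξ ^ 2) (hCπ : 0 ≤ Cπ)
    (hπn : ∀ X, ‖π X‖ ≤ Cπ * ‖X‖) (hπR : ∀ μ x X, π (R (U μ x)⁻¹ X) = R (U μ x)⁻¹ (π X)) (μ : ι) (x : S) :
    ‖F311 T π ξ U A μ x - π ((((ξ : ℂ)⁻¹) ^ 2) • curvOp T U A μ x)‖
      ≤ (Fintype.card ι - 1) * (Cπ * (C311 ρ + 2 * ρ ^ 14) * α₂) := by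
  have hα₂ : 0 ≤ α₂ := (norm_nonneg _).trans (hA μ x)
  have h1 := norm_F311_le_linear T U hξ hξ1 hρ hU hα₀ hα₀1 hα₂1 hA hDA hP hCπ hπn hπR μ x
  have h2 := norm_pi_curvOp_le T U (π := π) hT hξ hρ hU hα₀ hA hP hCπ hπn μ x
  have hd : (0 : ℝ) ≤ Fintype.card ι - 1 := by
    have : (1 : ℝ) ≤ Fintype.card ι := by exact_mod_cast Fintype.card_pos_iff.mpr ⟨μ⟩
    linarith
  have hρ14 : 0 ≤ ρ ^ 14 := by positivity
  calc ‖F311 T π ξ U A μ x - π ((((ξ : ℂ)⁻¹) ^ 2) • curvOp T U A μ x)‖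
      ≤ (Fintype.card ι - 1) * (Cπ * C311 ρ * α₂) + (Fintype.card ι - 1) * (2 * Cπ * ρ ^ 14 * α₀ * α₂) :=
        norm_sub_le_of_le h1 h2
    _ ≤ (Fintype.card ι - 1) * (Cπ * C311 ρ * α₂) + (Fintype.card ι - 1) * (2 * Cπ * ρ ^ 14 * 1 * α₂) := by
        gcongr
    _ = (Fintype.card ι - 1) * (Cπ * (C311 ρ + 2 * ρ ^ 14) * α₂) := by ring

end Units

/-! ## §3. On the torus: `𝐅₁`, the J-argument of (3.13), and its membership bound -/

section Torus

variable {P : Params} {i : ℕ} {𝔸 : Type*} [NormedRing 𝔸] [NormedAlgebra ℂ 𝔸] [CompleteSpace 𝔸]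
variable {ρ ξ Cπ α₀ α₂ : ℝ} {π : 𝔸 →ₗ[ℂ] 𝔸} {U : PBond P i → 𝔸ˣ} {A : PBond P i → 𝔸}

/-- **The bound on `𝐅₁(U, 𝐀)(b) = 𝐅(U, 𝐀)(b) − π(ξ⁻²(𝒦𝐀)(b))` on the torus**, in the letters of the spaces (1.11)–(1.14)
(`B12RegularSpaces111.plaq/nabla`): `‖𝐅₁(U, 𝐀)(b)‖ ≤ (d − 1)·Cπ·(C_F(ρ) + 2ρ¹⁴)·α₂`.
[cite: Balaban1987RG1, (3.11)–(3.14) p.272; Balaban1985Variational, (135) p.298] -/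
theorem norm_FOne_le_torus (hξ : 0 < ξ) (hξ1 : ξ ≤ 1) (hρ : 1 ≤ ρ)
    (hU : ∀ b, ‖(U b : 𝔸)‖ ≤ ρ ∧ ‖(((U b)⁻¹ : 𝔸ˣ) : 𝔸)‖ ≤ ρ) (hα₀ : 0 ≤ α₀) (hα₀1 : α₀ ≤ 1) (hα₂1 : α₂ ≤ 1)
    (hA : ∀ b, ‖A b‖ ≤ α₂) (hDA : ∀ μ ν x, ‖B12RegularSpaces111.nabla ξ U μ (fun y => A ⟨y, ν⟩) x‖ ≤ α₂)
    (hP : ∀ p : Plaq P i, ‖((B12RegularSpaces111.plaq U p : 𝔸ˣ) : 𝔸) - 1‖ ≤ α₀ * ξ ^ 2) (hCπ : 0 ≤ Cπ)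
    (hπn : ∀ X, ‖π X‖ ≤ Cπ * ‖X‖) (hπR : ∀ b X, π (R (U b)⁻¹ X) = R (U b)⁻¹ (π X)) (b : PBond P i) :
    ‖rem311 π ξ U A b
        - π ((((ξ : ℂ)⁻¹) ^ 2) • curvOp (torusT P i) (B12Eq18Current.dirForm U) (B12Eq18Current.dirForm A) b.dir b.src)‖
      ≤ (P.d - 1) * (Cπ * (C311 ρ + 2 * ρ ^ 14) * α₂) := by
  have h := norm_FOne_le (torusT P i) (B12Eq18Current.dirForm U) (A := B12Eq18Current.dirForm A) (π := π)
    torusT_comm hξ hξ1 hρ (fun μ x => hU ⟨x, μ⟩) hα₀ hα₀1 hα₂1 (fun μ x => hA ⟨x, μ⟩)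
    (fun κ ν y => (norm_eta_inv_smul_le_iff hξ _).mp (by rw [← nabla_eq_smul_covD]; exact hDA κ ν y))
    (fun κ ν hκν y => by rw [← B12Eq18Current.plaq_eq_plaqU U ⟨y, κ, ν, hκν⟩]; exact hP _) hCπ hπn
    (fun μ x X => hπR ⟨x, μ⟩ X) b.dir b.src
  rw [Fintype.card_fin] at h
  exact h

omit [CompleteSpace 𝔸] in
/-- **The J-argument of (3.13) assembled**: for `π` commuting with the transports and `𝐀` in the Landau gauge `R(ξ⁻¹D^{ξ*}𝐀) = 0`
(`R + P = I`), the current of the substituted configuration (3.10) is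
`J(e^{iξ𝐀}U)(b) = J(U)(b) + π(Δ^ξ_U𝐀)(b) − π(P₁𝐀)(b) + 𝐅₁(U, 𝐀)(b)` with `P₁𝐀 = D^ξ P ξ⁻¹D^{ξ*}𝐀` and
`𝐅₁(U, 𝐀) = 𝐅(U, 𝐀) − π(ξ⁻²𝒦𝐀)` — (3.11) (`eq311_current`) followed by the Landau replacement (`B12Eq311Landau.lapCur_landau`);
at `U = U_{k+1}` the first term is `(L^kη)³𝐉` by (3.12) (`eq312_scale`). [cite: Balaban1987RG1, (3.10)–(3.13) p.272] -/
theorem current_sub310_landau [CompleteSpace 𝔸] (π : 𝔸 →ₗ[ℂ] 𝔸) (ξ : ℝ) (U : PBond P i → 𝔸ˣ) (A : PBond P i → 𝔸)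
    (hπR : ∀ b X, π (R (U b)⁻¹ X) = R (U b)⁻¹ (π X)) (Rop Pop : (Site P i → 𝔸) → (Site P i → 𝔸))
    (hRP : ∀ f : Site P i → 𝔸, Rop f + Pop f = f)
    (hL : Rop (fun y => ((ξ : ℂ)⁻¹) • divB (torusT P i) (B12Eq18Current.dirForm U) (B12Eq18Current.dirForm A) y) = 0)
    (b : PBond P i) :
    B12Eq18Current.current π ξ (sub310 ξ A U) b
      = B12Eq18Current.current π ξ U b
        + π (siteLap (torusT P i) (B12Eq18Current.dirForm U) ξ (B12Eq18Current.dirForm A b.dir) b.src)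
        - π (covDη (torusT P i) (B12Eq18Current.dirForm U) ξ
              (Pop (fun y => ((ξ : ℂ)⁻¹) • divB (torusT P i) (B12Eq18Current.dirForm U) (B12Eq18Current.dirForm A) y))
              b.dir b.src)
        + (rem311 π ξ U A b
            - π ((((ξ : ℂ)⁻¹) ^ 2) • curvOp (torusT P i) (B12Eq18Current.dirForm U) (B12Eq18Current.dirForm A)
                b.dir b.src)) := by
  rw [eq311_current, lapCur_landau π ξ U A hπR Rop Pop hRP hL b, map_sub, map_sub]
  abel

omit [CompleteSpace 𝔸] in
/-- **[B12 (3.13)–(3.14), the 𝐉-slot with the 𝐅₁-bound DERIVED]**: for `(𝐔, 𝐉)` with `‖𝐔(b)^{±1}‖ ≤ ρ` (`1 ≤ ρ`), `‖𝐉‖ < α₀`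
(«notice the different constant in the bound for 𝐉»), `𝐀` with `|𝐀|, |∇^ξ_𝐔𝐀| ≤ α₂ ≤ 1`, `|∂𝐔 − 1| ≤ α₀ξ²` (`0 ≤ α₀ ≤ 1`,
`0 < ξ ≤ 1`), the two (3.14)-quantities `‖π(Δ^ξ_𝐔𝐀)(b)‖, ‖π(P₁𝐀)(b)‖ < α₂`, `π` with `‖πX‖ ≤ Cπ‖X‖` commuting with the transports,
and the scaling `j ≥ 1`, `L^jη ≤ 1`, `L > 1`: the J-argument of (3.13) at the bond `b`,
`(L^{j−1}η)³𝐉 + π(Δ^ξ_𝐔𝐀)(b) − π(P₁𝐀)(b) + 𝐅₁(𝐔, 𝐀)(b)`, has norm `< α₀` under the explicit restriction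
`(2 + C_F)α₂ ≤ (1 − L⁻³)α₀`, `C_F = (d − 1)·Cπ·(C_F(ρ) + 2ρ¹⁴)` — `B12Membership313J.jArg_norm_lt` with its hypothesis `‖𝐅₁‖ ≤ C_F·α₂`
discharged by `norm_FOne_le_torus`. [cite: Balaban1987RG1, (3.13)–(3.14) p.272 with (1.14) p.262] -/
theorem jSlot_norm_lt [CompleteSpace 𝔸] {L η : ℝ} {j : ℕ} {Jb : 𝔸} (Pop : (Site P i → 𝔸) → (Site P i → 𝔸))
    (hL : 1 < L) (hη : 0 ≤ η) (hj : 1 ≤ j) (hscale : L ^ j * η ≤ 1)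
    (hξ : 0 < ξ) (hξ1 : ξ ≤ 1) (hρ : 1 ≤ ρ)
    (hU : ∀ b, ‖(U b : 𝔸)‖ ≤ ρ ∧ ‖(((U b)⁻¹ : 𝔸ˣ) : 𝔸)‖ ≤ ρ) (hα₀ : 0 ≤ α₀) (hα₀1 : α₀ ≤ 1) (hα₂1 : α₂ ≤ 1)
    (hA : ∀ b, ‖A b‖ ≤ α₂) (hDA : ∀ μ ν x, ‖B12RegularSpaces111.nabla ξ U μ (fun y => A ⟨y, ν⟩) x‖ ≤ α₂)
    (hP : ∀ p : Plaq P i, ‖((B12RegularSpaces111.plaq U p : 𝔸ˣ) : 𝔸) - 1‖ ≤ α₀ * ξ ^ 2) (hCπ : 0 ≤ Cπ)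
    (hπn : ∀ X, ‖π X‖ ≤ Cπ * ‖X‖) (hπR : ∀ b X, π (R (U b)⁻¹ X) = R (U b)⁻¹ (π X)) (b : PBond P i)
    (hJ : ‖Jb‖ < α₀)
    (hΔ : ‖π (siteLap (torusT P i) (B12Eq18Current.dirForm U) ξ (B12Eq18Current.dirForm A b.dir) b.src)‖ < α₂)
    (hP₁ : ‖π (covDη (torusT P i) (B12Eq18Current.dirForm U) ξ
              (Pop (fun y => ((ξ : ℂ)⁻¹) • divB (torusT P i) (B12Eq18Current.dirForm U) (B12Eq18Current.dirForm A) y))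
              b.dir b.src)‖ < α₂)
    (hres : (2 + (P.d - 1) * (Cπ * (C311 ρ + 2 * ρ ^ 14))) * α₂ ≤ (1 - L⁻¹ ^ 3) * α₀) :
    ‖(L ^ (j - 1) * η) ^ 3 • Jb
        + π (siteLap (torusT P i) (B12Eq18Current.dirForm U) ξ (B12Eq18Current.dirForm A b.dir) b.src)
        - π (covDη (torusT P i) (B12Eq18Current.dirForm U) ξ
              (Pop (fun y => ((ξ : ℂ)⁻¹) • divB (torusT P i) (B12Eq18Current.dirForm U) (B12Eq18Current.dirForm A) y))
              b.dir b.src)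
        + (rem311 π ξ U A b
            - π ((((ξ : ℂ)⁻¹) ^ 2) • curvOp (torusT P i) (B12Eq18Current.dirForm U) (B12Eq18Current.dirForm A)
                b.dir b.src))‖ < α₀ := by
  have hF := norm_FOne_le_torus (π := π) hξ hξ1 hρ hU hα₀ hα₀1 hα₂1 hA hDA hP hCπ hπn hπR b
  rw [show (P.d - 1) * (Cπ * (C311 ρ + 2 * ρ ^ 14) * α₂) = (P.d - 1) * (Cπ * (C311 ρ + 2 * ρ ^ 14)) * α₂ by ring] at hF
  exact B12Membership313J.jArg_norm_lt hL hη hj hscale hJ hΔ hP₁ hF hres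

end Torus

end

end Literature.MathematicalPhysics.QuantumFieldTheory.Balaban1983to89.B12Eq313JSlot
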